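import Summits.NavierStokesRegularity.NavierStokesRegularity.Theses.QuantisedSymmetry
import Summits.NavierStokesRegularity.NavierStokesRegularity.Theses.Blowup
import Summits.NavierStokesRegularity.NavierStokesRegularity.Theses.DssFarFieldSlaving
import Summits.NavierStokesRegularity.NavierStokesRegularity.Theorems.QuantisedSymmetryPolyhedralTruncationBridge
import Summits.NavierStokesRegularity.NavierStokesRegularity.Theorems.DssFarFieldSlavingDssTruncationBridge
import Summits.NavierStokesRegularity.NavierStokesRegularity.Theorems.QuantisedSymmetryPolyhedralDssProfileExistsDominatesBlowupProfile
import Literature.Analysis.FluidPDE.HyperbolicDSSOrbit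
import HarnessLib

/-!
# Strategist sketch `s14-g7` (family `s`, gen 7, independent census) for crux
# `QuantisedSymmetry.PolyhedralDssProfileExists` (stmt-NavierStokesRegularity-1404)

Typed companion of `STRATEGY-CENSUS-s14.md`: every claim of the census that is a statement about the TREE is
checked here (no `sorry`).  Sections follow the census: §0 summit strength, §1 weaker intermediates,
§2 decomposition `D4 = A ∧ R`, §4 strengthening `S⁺`.  Nothing here is a line or a stub; it is evidence.
-/

set_option linter.dupNamespace false
set_option autoImplicit false

namespace Summit.NavierStokesRegularity.NavierStokesRegularity.Cruxes.PolyhedralDssProfileExists.S14g7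

open MeasureTheory
open Literature.Analysis.FluidPDE
open _root_.Summit.NavierStokesRegularity.NavierStokesRegularity

local notation "ℝ³" => EuclideanSpace ℝ (Fin 3)

/-! ## §0  The crux alone decides the summit (negatively) -/

/-- **Summit strength, typed.** Both co-binders of the route's deciding theorem are tree theorems
(`quantisedSymmetry_polyhedralTruncationBridge_proof`, `ClayUniqueness_holds`), so the crux `C` alone refutes the
Clay statement: `C → ¬S`.  This is the theorem that makes `C` summit-strength on the negative side. -/
theorem crux_decides_negatively
    (hX : Theses.QuantisedSymmetry.PolyhedralDssProfileExists) : ¬ _root_.NavierStokesRegularity :=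
  Theses.QuantisedSymmetry.closes hX Theorems.quantisedSymmetry_polyhedralTruncationBridge_proof
    Theses.QuantisedSymmetry.ClayUniqueness_holds

/-! ## §1  Weaker intermediates read off the summit statement -/

/-- **W1 (drop the symmetry group).** The sector-free weakening is the already-filed crux
`Blowup.BlowupTypeIDssProfile` (stmt-0155); `C → W1` is the registered stub proved in the tree. -/
theorem w1_of_crux (hX : Theses.QuantisedSymmetry.PolyhedralDssProfileExists) :
    Theses.Blowup.BlowupTypeIDssProfile :=
  Theorems.PolyhedralDssProfileExists.PolyhedralCell.stub_dominatesBlowupProfile hX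

/-- **W1 already decides the summit** (tree: `DssFarFieldSlaving.closes` + `dssTruncationBridge_proof`), so
replacing `C` by `W1` is a change of ROUTE (to `Blowup`/`DssFarFieldSlaving`), not a strategy for this crux:
it abandons the only lever (`G`) and gains no tool. -/
theorem w1_decides (hW : Theses.Blowup.BlowupTypeIDssProfile) : ¬ _root_.NavierStokesRegularity :=
  Theses.DssFarFieldSlaving.closes Theorems.dssTruncationBridge_proof hW

/-- **W2 (drop discrete self-similarity) = piece `A` of the decomposition `D4`.**  A nontrivial
`G`-equivariant ancient mild solution with the Type-I space-time bound `|u| ≤ C₀/(|x|+√(-t))`, `G` finite,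
orientation-preserving and irreducible on `ℝ³`.  Strictly weaker than `C` (no period), the negative side of a
sectorial KNSS/Type-I Liouville statement; it does NOT reach `¬S` in the tree (no truncation bridge for
non-DSS Type-I ancient solutions is proved or filed). -/
def W2 : Prop :=
  ∃ G : Subgroup (ℝ³ ≃ₗᵢ[ℝ] ℝ³), Finite G ∧
    (∀ g ∈ G, LinearMap.det (g.toLinearEquiv : ℝ³ →ₗ[ℝ] ℝ³) = 1) ∧
    (∀ V : Submodule ℝ ℝ³, (∀ g ∈ G, ∀ v ∈ V, g v ∈ V) → V = ⊥ ∨ V = ⊤) ∧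
    ∃ u : ℝ → ℝ³ → ℝ³, IsAncientMildSolution 1 u ∧ (∀ t < 0, AEStronglyMeasurable (u t) volume) ∧
      (∃ C₀ : ℝ, HasTypeIDecay C₀ u) ∧ (∀ g ∈ G, ∀ t x, u t (g x) = g (u t x)) ∧
      ¬ (∀ t < 0, u t =ᵐ[volume] 0)

/-- `C → W2`: forget the period. -/
theorem w2_of_crux (hX : Theses.QuantisedSymmetry.PolyhedralDssProfileExists) : W2 := by
  obtain ⟨G, hfin, hdet, hirr, c, -, u, hanc, hmeas, -, hdec, hsym, hnt⟩ := hX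
  exact ⟨G, hfin, hdet, hirr, u, hanc, hmeas, hdec, hsym, hnt⟩

/-! ## §2  Decomposition `D4`: `C ⇐ A ∧ R` with `A = W2` and `R` a DSS-rigidity statement -/

/-- **Piece `R` (rigidity / periodic zoom limit).** In every admissible sector `G`, the existence of SOME
nontrivial `G`-equivariant Type-I ancient mild solution forces the existence of a DISCRETELY SELF-SIMILAR
one (for some factor `c > 1`).  Informally: "a Type-I ancient `G`-flow has a nontrivial time-periodic
zoom limit".  This is the hard half; nothing in print supports it (zoom limits of Type-I ancient solutions
exist by compactness but need be neither nontrivial-and-periodic nor periodic at all). -/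
def R : Prop :=
  ∀ G : Subgroup (ℝ³ ≃ₗᵢ[ℝ] ℝ³), Finite G →
    (∀ g ∈ G, LinearMap.det (g.toLinearEquiv : ℝ³ →ₗ[ℝ] ℝ³) = 1) →
    (∀ V : Submodule ℝ ℝ³, (∀ g ∈ G, ∀ v ∈ V, g v ∈ V) → V = ⊥ ∨ V = ⊤) →
    (∃ u : ℝ → ℝ³ → ℝ³, IsAncientMildSolution 1 u ∧ (∀ t < 0, AEStronglyMeasurable (u t) volume) ∧
      (∃ C₀ : ℝ, HasTypeIDecay C₀ u) ∧ (∀ g ∈ G, ∀ t x, u t (g x) = g (u t x)) ∧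
      ¬ (∀ t < 0, u t =ᵐ[volume] 0)) →
    ∃ c : ℝ, 1 < c ∧ ∃ v : ℝ → ℝ³ → ℝ³, IsAncientMildSolution 1 v ∧
      (∀ t < 0, AEStronglyMeasurable (v t) volume) ∧ IsDiscretelySelfSimilar c v ∧
      (∃ C₀ : ℝ, HasTypeIDecay C₀ v) ∧ (∀ g ∈ G, ∀ t x, v t (g x) = g (v t x)) ∧
      ¬ (∀ t < 0, v t =ᵐ[volume] 0)

/-- **Assembly of `D4` (proved; trivial seam).** `A → R → C`.  Census verdict: (a) two pieces, (b) assembly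
proved, (c) neither piece gives `C` or `S` alone (`A` is DSS-free; `R` is an implication with an open
antecedent), but (d) FAILS: neither piece has a plan (A = sectorial Type-I Liouville negative side, no
mechanism; R = unfounded rigidity), so the split is recorded, not filed. -/
theorem crux_of_D4 (hA : W2) (hR : R) : Theses.QuantisedSymmetry.PolyhedralDssProfileExists := by
  obtain ⟨G, hfin, hdet, hirr, u, hanc, hmeas, hdec, hsym, hnt⟩ := hA
  obtain ⟨c, hc, v, hvanc, hvmeas, hvdss, hvdec, hvsym, hvnt⟩ :=
    hR G hfin hdet hirr ⟨u, hanc, hmeas, hdec, hsym, hnt⟩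
  exact ⟨G, hfin, hdet, hirr, c, hc, v, hvanc, hvmeas, hvdss, hvdec, hvsym, hvnt⟩

/-! ## §4  Strengthening `S⁺`: a HYPERBOLIC polyhedral DSS orbit -/

/-- **`S⁺` (hyperbolic orbit).** The crux witness with, in addition, a hyperbolic linearised monodromy of its
Leray orbit (`IsHyperbolicTypeIDSSOrbit c 1 u`, the notion filed for `DssFarFieldSlaving`).  Hyperbolicity is
what a computer-assisted Newton–Kantorovich proof would certify and what a stable-manifold truncation uses —
but the truncation bridge is ALREADY proved without it, so `S⁺` buys nothing on the summit path and is
harder, not easier, to produce. -/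
def SPlusHyperbolic : Prop :=
  ∃ G : Subgroup (ℝ³ ≃ₗᵢ[ℝ] ℝ³), Finite G ∧
    (∀ g ∈ G, LinearMap.det (g.toLinearEquiv : ℝ³ →ₗ[ℝ] ℝ³) = 1) ∧
    (∀ V : Submodule ℝ ℝ³, (∀ g ∈ G, ∀ v ∈ V, g v ∈ V) → V = ⊥ ∨ V = ⊤) ∧
    ∃ c : ℝ, 1 < c ∧ ∃ u : ℝ → ℝ³ → ℝ³, IsAncientMildSolution 1 u ∧
      (∀ t < 0, AEStronglyMeasurable (u t) volume) ∧ IsDiscretelySelfSimilar c u ∧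
      (∃ C₀ : ℝ, HasTypeIDecay C₀ u) ∧ (∀ g ∈ G, ∀ t x, u t (g x) = g (u t x)) ∧
      ¬ (∀ t < 0, u t =ᵐ[volume] 0) ∧
      IsHyperbolicTypeIDSSOrbit c (LinearIsometryEquiv.refl ℝ ℝ³) u

/-- `S⁺ → C`: forget hyperbolicity. -/
theorem crux_of_SPlus (h : SPlusHyperbolic) : Theses.QuantisedSymmetry.PolyhedralDssProfileExists := by
  obtain ⟨G, hfin, hdet, hirr, c, hc, u, hanc, hmeas, hdss, hdec, hsym, hnt, -⟩ := h
  exact ⟨G, hfin, hdet, hirr, c, hc, u, hanc, hmeas, hdss, hdec, hsym, hnt⟩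

/-! ## Summary of the typed facts

* `crux_decides_negatively : C → ¬S` — the crux is summit-strength (negative side);
* `w1_of_crux`, `w1_decides` — the only strictly-weaker intermediate that still decides is stmt-0155, itself
  summit-deciding and engine-less;
* `w2_of_crux`, `crux_of_D4` — the honest split `C ⇐ W2 ∧ R` type-checks with a proved seam, but both pieces
  are planless (census §Decomposition);
* `crux_of_SPlus` — the natural strengthening only adds a certification burden.
-/

end Summit.NavierStokesRegularity.NavierStokesRegularity.Cruxes.PolyhedralDssProfileExists.S14g7
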